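import Literature.Topology.FourManifolds.ThreeTorusHomologyTwo
import Literature.AlgebraicTopology.SingularHomology.PoincareDualityClosed
import HarnessLib

/-!
# `H₂(T_A ∖ C; ℤ) = 0` for a Cappell–Shaneson mapping torus: the discharge

Sibling proof file of `CappellShanesonHomology.lean`, which states as a named fact (D-0014)
`Literature.Topology.FourManifolds.isZero_singularHomology_two_mappingTorus_compl_sectionCircle`:
for `A ∈ SL(3, ℤ)` with `det (A - 1) = ±1`, the mapping torus `T = T_A` of the linear
diffeomorphism `torusMap A` of `T³`, minus its section circle `C` through the fixed point `1`,
has `H₂(T ∖ C; ℤ) = 0` (S. E. Cappell, J. L. Shaneson, *Some new four-manifolds*, Ann. of Math.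
104 (1976) 61–72, §2: when `det (A - 1) = ±1` the mapping torus is a homology `S¹ × S³` and the
complement of the section circle a homology circle — the Wang sequence of the `T³ ∖ pt`-bundle
`T_A ∖ C → S¹` with `A - 1` and `Λ²A - 1` invertible over `ℤ`). Here that fact is **proved**:
`Literature.Topology.FourManifolds.isZero_singularHomology_two_mappingTorus_compl_sectionCircle_holds`.

Every ingredient is a theorem of the tree; this file only joins them:

* the reduction `isZero_singularHomology_two_mappingTorus_compl_sectionCircle_of_facts`
  (`CappellShanesonWang.lean`): `T_A ∖ C` is the glued mapping torus of `(torusMap A)|_{T³ ∖ 1}`,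
  whose `H₂` vanishes by the Wang / Mayer–Vietoris criterion (Hatcher, *Algebraic Topology*,
  Example 2.48) as soon as `A_* - 1` is injective on `H₁(T³ ∖ 1; ℤ)` and surjective on
  `H₂(T³ ∖ 1; ℤ)`, granted excision, Mayer–Vietoris exactness and two torus facts;
* excision `relativeSingularHomology.isIso_map_of_interior_union_interior_holds` (Hatcher Thm. 2.20,
  `…SingularHomology.ExcisionTheorem`) and Mayer–Vietoris exactness `mayerVietoris.exact₁_holds`,
  `mayerVietoris.exact₂_holds` (Hatcher §2.2, `…SingularHomology.MayerVietorisExactness`);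
* the puncture comparison `isIso_singularHomology_map_puncturedThreeTorusIncl_holds`
  (`CappellShanesonWangProofs.lean`; Hatcher Thm. 3.26);
* the homology of `T³` with its `SL(3, ℤ)`-action, `singularHomology_threeTorus_linear`
  (Hatcher §3.C Ex. 11): its `H₁` half is proved outright in `ThreeTorusHomologyOne.lean` and its
  `H₂` half in `ThreeTorusHomologyTwo.lean` from Poincaré duality for `T³` in degrees `(1, 2)`
  (`singularHomology_threeTorus_linear_of_poincareDuality`), and Poincaré duality for closed
  oriented manifolds `X : Type` of dimension `n ≥ 1` is now the theorem
  `Literature.AlgebraicTopology.SingularHomology.bijective_poincareDualityMap_of_one_le`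
  (`…SingularHomology.PoincareDualityClosed`, Hatcher Thm. 3.30). We record the instance
  `bijective_poincareDualityMap_threeTorus` and the discharge
  `singularHomology_threeTorus_linear_holds` of that named fact on the way.

Everything here is proved; no definitions, no named facts are introduced.

## References

* S. E. Cappell, J. L. Shaneson, *Some new four-manifolds*, Ann. of Math. (2) 104 (1976) 61–72,
  §2 [CappellShanesonAnnals1976].
* A. Hatcher, *Algebraic Topology*, CUP 2002, Thm. 2.20, §2.2 Example 2.48, §3.3 Thm. 3.26,
  Thm. 3.30, §3.C Exercise 11 [HatcherAT2002].
-/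

noncomputable section

open CategoryTheory Limits
open Literature.AlgebraicTopology.SingularHomology

namespace Literature.Topology.FourManifolds

/-! ### Poincaré duality for `T³` and the homology of `T³` with its `SL(3, ℤ)`-action -/

/-- **Poincaré duality for the 3-torus in degrees `(1, 2)`**: `a ↦ a ⌢ [T³] : H¹(T³; ℤ) → H₂(T³; ℤ)`
is bijective, for the closed topological 3-manifold structure `threeTorusChartedSpaceFinThree` and
the orientation `ThreeTorus.homologicalOrientation` — the instance `X = T³`, `n = 3`, `(p, q) =
(1, 2)` of Poincaré duality for closed oriented manifolds (Hatcher 2002, Thm. 3.30), proved in the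
tree as `bijective_poincareDualityMap_of_one_le`. This is the hypothesis `PD₃` of
`ThreeTorusHomologyTwo.lean`. [cite: HatcherAT2002, §3.3 Thm. 3.30] -/
theorem bijective_poincareDualityMap_threeTorus :
    @bijective_poincareDualityMap ℤ _ ThreeTorus _ 1 2 3 _ _ threeTorusChartedSpaceFinThree
      ThreeTorus.homologicalOrientation rfl := by
  letI := threeTorusChartedSpaceFinThree
  exact bijective_poincareDualityMap_of_one_le (by norm_num) ThreeTorus.homologicalOrientation rfl

/-- **Discharge of the named fact `Literature.Topology.FourManifolds.singularHomology_threeTorus_linear`**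
(`CappellShanesonWang.lean`; Hatcher 2002, §3.C Exercise 11 / Example 3.16): `H₁(T³; ℤ) ≅ ℤ³` and
`H₂(T³; ℤ) ≅ ℤ³` with `torusMap A`, `A ∈ SL(3, ℤ)`, acting by `A` and by `(A⁻¹)ᵀ`. The `H₁` half is
`ThreeTorusHomologyOne.lean`; the `H₂` half is its Poincaré dual (`ThreeTorusHomologyTwo.lean`,
`singularHomology_threeTorus_linear_of_poincareDuality`), Poincaré duality for `T³` being
`bijective_poincareDualityMap_threeTorus`. [cite: HatcherAT2002, §3.C Exercise 11] -/
theorem singularHomology_threeTorus_linear_holds : singularHomology_threeTorus_linear :=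
  singularHomology_threeTorus_linear_of_poincareDuality bijective_poincareDualityMap_threeTorus

/-! ### The discharge -/

/-- **Cappell–Shaneson 1976, §2: `H₂(T_A ∖ C; ℤ) = 0`** — discharge of the named fact
`Literature.Topology.FourManifolds.isZero_singularHomology_two_mappingTorus_compl_sectionCircle` of
`CappellShanesonHomology.lean`. For `A ∈ SL(3, ℤ)` with `det (A - 1) = ±1`, the smooth mapping
torus `T` of `torusMap A` on `T³` (glued from `T³ × (0, 1)` and `T³ × (1/2, 3/2)` along
`mappingTorusRel (torusDiffeomorph A)`) minus the section circle `c` through `1 ∈ T³` has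
`H₂(T ∖ c(𝕊¹); ℤ) = 0`. Proof: the reduction
`isZero_singularHomology_two_mappingTorus_compl_sectionCircle_of_facts` (the Wang sequence of the
`T³ ∖ pt`-bundle `T ∖ c`, Hatcher Example 2.48, with `A - 1` injective on `H₁ = ℤ³` and
`(A⁻¹)ᵀ - 1` surjective on `H₂ = ℤ³` since `det (A - 1) = ±1`, `det (A⁻¹ - 1) = -det (A - 1)`), fed
with the theorems of the tree: excision (Hatcher Thm. 2.20), Mayer–Vietoris exactness (§2.2), the
homology of `T³` with its `SL(3, ℤ)`-action (`singularHomology_threeTorus_linear_holds`) and the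
puncture comparison `T³ ∖ 1 ↪ T³` (`isIso_singularHomology_map_puncturedThreeTorusIncl_holds`).
[cite: CappellShanesonAnnals1976, §2] -/
theorem isZero_singularHomology_two_mappingTorus_compl_sectionCircle_holds :
    isZero_singularHomology_two_mappingTorus_compl_sectionCircle :=
  isZero_singularHomology_two_mappingTorus_compl_sectionCircle_of_facts
    (fun S _ => relativeSingularHomology.isIso_map_of_interior_union_interior_holds ℤ ℤ S)
    (fun _ _ U V => mayerVietoris.exact₁_holds ℤ ℤ U V)
    (fun _ _ U V => mayerVietoris.exact₂_holds ℤ ℤ U V)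
    singularHomology_threeTorus_linear_holds
    isIso_singularHomology_map_puncturedThreeTorusIncl_holds

end Literature.Topology.FourManifolds

end
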